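import Mathlib
import HarnessLib
import Summits.HubbardSuperconductivity.HubbardSuperconductivity.Theorems.ComplexGFFStiffnessDefs
import Literature.MathematicalPhysics.StatisticalMechanics.TaylorPolynomialNorms
import Literature.MathematicalPhysics.StatisticalMechanics.TaylorPolynomialNormsPullback
import Literature.MathematicalPhysics.StatisticalMechanics.GradientFieldNorms

/-!
# Line `gnv`, stub `stub_gnvOfFrd`: the initial polymer activity of an `ι`-admissible
# perturbation is in the weighted `T_φ` ball (ABKM19 Lemma 12.3 ⊗ ℂ on the `ι`-symmetric class)

Crux `HypACumulant` (stmt-HubbardSuperconductivity-19154) / sibling `HypALocalTwoPoint` (…-19155),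
line `gnv`, research stub `stub_gnvOfFrd : TorusFRD 4 → GNV`.  The renormalisation-group proof of
`GNV` (Adams–Buchholz–Kotecký–Müller, arXiv:1910.13564, Thm 2.2 via Chs. 4–12) starts by writing
`pertZ n K = Z₀ · E_{μ}[∏_x (1 + K(∇φ(x)))] = Z₀ · E_μ[Σ_X ∏_{x∈X} K(∇φ(x))]` (landed:
`pertZ_eq_mul_integral_greenMat`, `PolymerCircleProduct`) and feeding the POLYMER ACTIVITY
`I(K)(X, φ) = ∏_{x∈X} K(∇φ(x))` into the multiscale machine as the scale-`0` perturbation.  The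
machine measures functionals by the Taylor norms `‖·‖_{T_φ}` of [ABKM19] Ch. 6.4 / App. A
(`Literature/…/TaylorPolynomialNorms.lean`, gauge `fieldGauge 𝔥 R p S` of
`Literature/…/GradientFieldNorms.lean`), divided by a large-field weight; at scale `0` the weight is
`w_{-1:0}^X(φ) = exp(½(1−ζ) Σ_{x∈X} 𝒬(∇φ(x)))` ([ABKM19] (12.13)), here `ζ = 1/2`, `𝒬 = |·|²`:
`exp(¼ Σ_{x∈X} |∇φ(x)|²)` — exactly the weight in `IsIotaAdmissible`.

This file proves the ENTRY ESTIMATE of the flow, [ABKM19] Lemma 12.3 ((12.17)–(12.18)), for the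
COMPLEX `ι`-admissible class of `GNV`:

* `tayNorm_pertSite_le` — for `IsIotaAdmissible r₀ ρ K`, `x ∈ S`, gauge parameters `𝔥, R > 0`,
  `p ≥ 1`:  `‖K(∇·(x))‖_{T_φ} ≤ ρ · e^{𝔥/R} · e^{¼|∇φ(x)|²}`
  ([ABKM19] (12.17): `|I(𝒦)({x})|_{0,{x},T_φ} ≤ 2^{R₀} d r₀ h^{r₀} ‖𝒦‖_ζ w_{-1:0}^{{x}}(φ)`; our
  constant `e^{𝔥/R}` replaces `2^{R₀}dr₀h^{r₀}` because `IsIotaAdmissible` bounds multilinear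
  operator norms of `D^s K` rather than `Σ_γ |∂^γ K|/γ!`);
* `tayNorm_pertActivity_le` — for `X ⊆ S`:
  `‖∏_{x∈X} K(∇·(x))‖_{T_φ} ≤ (ρ e^{𝔥/R})^{|X|} · exp(¼ Σ_{x∈X} |∇φ(x)|²)`
  ([ABKM19] (12.18), by the product property `tayNorm_prod_le`);
* `isGaugeLocal_pertActivity` — the activity is local for the gauge (it lies in `M(𝒫_0)`);
* `tayNorm_conj_neg`, `tayNorm_neg_of_iota`, `tayNorm_pertActivity_neg` — the Taylor norm of
  `ι F = conj ∘ F ∘ (−·)` at `φ` equals that of `F` at `−φ` (any gauge), so on the `ι`-symmetric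
  class — in particular for the activity of an `ι`-admissible `K` (`pertActivity_iota`) — the norms
  are even in the field: the norm apparatus does not see the complex structure.

So, in the weighted norm `‖F‖_{0,X} = sup_φ ‖F(X)‖_{T_φ} / w^X_{-1:0}(φ)` of the scale-`0` step,
the initial activity of every `K` in the `GNV` ball has norm `≤ (ρ e^{𝔥/R})^{|X|}`: the hypothesis
of `GNV` is now connected to the renormalisation-group norms.  What is NOT here: the weights
`w_k^X`, `W_k^X` of [ABKM19] Ch. 7 and the global weak norm `‖·‖_k^{(A)}` (sup over connected
polymers with `A^{|X|}`), i.e. the conclusion `‖I(K)‖_{-1:0}^{(4A)} ≤ C ρ` of Lemma 12.3.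
-/

noncomputable section

-- `Summit.<Summit>.<Problem>`: single-conjunct summit, the duplicate component is mandated (D-0017).
set_option linter.dupNamespace false

namespace Summit.HubbardSuperconductivity.HubbardSuperconductivity.Theorems.ComplexGFF

open Finset
open Literature.MathematicalPhysics.StatisticalMechanics.ComplexGradientGFF4 (D)
open Literature.MathematicalPhysics.StatisticalMechanics.GradientRG
  (fieldGauge gradAt tayNorm IsGaugeLocal tayNorm_comp_gradAt_le tayNorm_prod_le tayNorm_nonneg
    isGaugeLocal_comp_gradAt)

variable {n : ℕ} [NeZero n]

omit [NeZero n] in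
/-- The gauge library's gradient vector at `x` is the model's `(∂_i φ(x))_i`. -/
theorem gradAt_eq_D (x : Fin 4 → ZMod n) (φ : (Fin 4 → ZMod n) → ℝ) :
    gradAt x φ = fun i => D φ i x := rfl

omit [NeZero n] in
/-- The single-site functional `φ ↦ K(∇φ(x))` is `K ∘ gradAt x`. -/
theorem pertSite_eq_comp_gradAt (K : (Fin 4 → ℝ) → ℂ) (x : Fin 4 → ZMod n) :
    (fun φ : (Fin 4 → ZMod n) → ℝ => K (fun i => D φ i x)) = fun φ => K (gradAt x φ) := rfl

/-- The single-site functional of a `C^{r₀}` perturbation is `C^{r₀}` in the field. -/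
theorem contDiff_pertSite {r₀ : ℕ} {K : (Fin 4 → ℝ) → ℂ} (hK : ContDiff ℝ r₀ K)
    (x : Fin 4 → ZMod n) :
    ContDiff ℝ r₀ (fun φ : (Fin 4 → ZMod n) → ℝ => K (fun i => D φ i x)) := by
  rw [pertSite_eq_comp_gradAt]
  exact hK.comp (LinearMap.toContinuousLinearMap (gradAt x)).contDiff

/-- `Σ_{s ≤ r₀} (s!)⁻¹ t^s ≤ e^t` for `t ≥ 0` (partial sums of the exponential series). -/
theorem sum_inv_factorial_mul_pow_le_exp {t : ℝ} (ht : 0 ≤ t) (r₀ : ℕ) :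
    ∑ s ∈ Finset.range (r₀ + 1), ((s.factorial : ℝ)⁻¹) * t ^ s ≤ Real.exp t := by
  have h := Real.sum_le_exp_of_nonneg ht (r₀ + 1)
  refine le_trans (le_of_eq (Finset.sum_congr rfl fun s _ => ?_)) h
  rw [div_eq_mul_inv, mul_comm]

/-- **Single-site entry estimate** ([ABKM19] Lemma 12.3, (12.17), on the complex `ι`-admissible
class): for an `ι`-admissible perturbation `K` (`IsIotaAdmissible r₀ ρ K`), a finite set of sites
`S ∋ x` and gauge parameters `𝔥, R > 0`, `p ≥ 1`,
`‖K(∇·(x))‖_{T_φ} ≤ ρ · e^{𝔥/R} · exp(¼ |∇φ(x)|²)`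
— the Taylor norm relative to the field gauge `T_{𝔥,R,p,S}` is bounded by `ρ e^{𝔥/R}` times the
scale-`0` weight `w_{-1:0}^{{x}}(φ)`. -/
theorem tayNorm_pertSite_le {r₀ : ℕ} {ρ : ℝ} {K : (Fin 4 → ℝ) → ℂ} (hK : IsIotaAdmissible r₀ ρ K)
    {𝔥 R : ℝ} (h𝔥 : 0 < 𝔥) (hR : 0 < R) {p : ℕ} (hp : 1 ≤ p) {S : Finset (Fin 4 → ZMod n)}
    {x : Fin 4 → ZMod n} (hx : x ∈ S) (φ : (Fin 4 → ZMod n) → ℝ) :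
    tayNorm (fieldGauge 𝔥 R p S) r₀ (fun φ : (Fin 4 → ZMod n) → ℝ => K (fun i => D φ i x)) φ ≤
      ρ * Real.exp (𝔥 / R) * Real.exp ((∑ i : Fin 4, (D φ i x) ^ 2) / 4) := by
  obtain ⟨hKdiff, hKbd, -⟩ := hK
  have hρ : 0 ≤ ρ := by
    have h0 : (0 : ℝ) ≤ ρ * Real.exp ((∑ i : Fin 4, ((0 : Fin 4 → ℝ) i) ^ 2) / 4) :=
      (norm_nonneg _).trans (hKbd 0 (Nat.zero_le _) 0)
    exact (mul_nonneg_iff_of_pos_right (Real.exp_pos _)).1 h0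
  set z : Fin 4 → ℝ := fun i => D φ i x with hz
  set w : ℝ := Real.exp ((∑ i : Fin 4, (D φ i x) ^ 2) / 4) with hw
  have hw0 : 0 ≤ w := (Real.exp_pos _).le
  have ht : 0 ≤ 𝔥 / R := div_nonneg h𝔥.le hR.le
  rw [pertSite_eq_comp_gradAt]
  refine (tayNorm_comp_gradAt_le h𝔥 hR hp hx hKdiff φ).trans ?_
  calc ∑ s ∈ Finset.range (r₀ + 1),
        ((s.factorial : ℝ)⁻¹) * (‖iteratedFDeriv ℝ s K (gradAt x φ)‖ * (𝔥 / R) ^ s)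
      ≤ ∑ s ∈ Finset.range (r₀ + 1), ((s.factorial : ℝ)⁻¹) * ((ρ * w) * (𝔥 / R) ^ s) := by
        refine Finset.sum_le_sum fun s hs => ?_
        have hs' : s ≤ r₀ := Nat.lt_succ_iff.1 (Finset.mem_range.1 hs)
        refine mul_le_mul_of_nonneg_left ?_ (inv_nonneg.2 (Nat.cast_nonneg _))
        refine mul_le_mul_of_nonneg_right ?_ (pow_nonneg ht _)
        rw [gradAt_eq_D]
        exact hKbd s hs' z
    _ = (ρ * w) * ∑ s ∈ Finset.range (r₀ + 1), ((s.factorial : ℝ)⁻¹) * (𝔥 / R) ^ s := by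
        rw [Finset.mul_sum]
        refine Finset.sum_congr rfl fun s _ => ?_
        ring
    _ ≤ (ρ * w) * Real.exp (𝔥 / R) :=
        mul_le_mul_of_nonneg_left (sum_inv_factorial_mul_pow_le_exp ht r₀) (mul_nonneg hρ hw0)
    _ = ρ * Real.exp (𝔥 / R) * w := by ring

/-- The polymer activity `φ ↦ ∏_{x∈X} K(∇φ(x))` is local for the gauge `T_{𝔥,R,p,S}` whenever
`X ⊆ S` (it is an element of `M(𝒫_0)`: [ABKM19], proof of Lemma 12.3, "the functional `I(𝒦)` is
translation invariant, shift invariant and local"). -/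
theorem isGaugeLocal_pertActivity (K : (Fin 4 → ℝ) → ℂ) {𝔥 R : ℝ} (h𝔥 : 0 < 𝔥) (hR : 0 < R)
    {p : ℕ} (hp : 1 ≤ p) {S X : Finset (Fin 4 → ZMod n)} (hXS : X ⊆ S) :
    IsGaugeLocal (fieldGauge 𝔥 R p S)
      (fun φ : (Fin 4 → ZMod n) → ℝ => ∏ x ∈ X, K (fun i => D φ i x)) :=
  IsGaugeLocal.prod X fun _ hx => isGaugeLocal_comp_gradAt h𝔥 hR hp (hXS hx) K

/-- **Entry estimate for the polymer activity** ([ABKM19] Lemma 12.3, (12.18), on the complex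
`ι`-admissible class): for `IsIotaAdmissible r₀ ρ K`, `X ⊆ S`, `𝔥, R > 0`, `p ≥ 1`,
`‖∏_{x∈X} K(∇·(x))‖_{T_φ} ≤ (ρ e^{𝔥/R})^{|X|} · exp(¼ Σ_{x∈X} |∇φ(x)|²)`,
i.e. the scale-`0` activity `I(K)(X)` has weighted norm `‖I(K)(X)‖_{T_φ} / w_{-1:0}^X(φ) ≤ (ρ e^{𝔥/R})^{|X|}`
uniformly in the field and the volume — by the single-site estimate and the product property of the
Taylor norm. -/
theorem tayNorm_pertActivity_le {r₀ : ℕ} {ρ : ℝ} {K : (Fin 4 → ℝ) → ℂ}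
    (hK : IsIotaAdmissible r₀ ρ K) {𝔥 R : ℝ} (h𝔥 : 0 < 𝔥) (hR : 0 < R) {p : ℕ} (hp : 1 ≤ p)
    {S X : Finset (Fin 4 → ZMod n)} (hXS : X ⊆ S) (φ : (Fin 4 → ZMod n) → ℝ) :
    tayNorm (fieldGauge 𝔥 R p S) r₀
        (fun φ : (Fin 4 → ZMod n) → ℝ => ∏ x ∈ X, K (fun i => D φ i x)) φ ≤
      (ρ * Real.exp (𝔥 / R)) ^ X.card *
        Real.exp ((∑ x ∈ X, ∑ i : Fin 4, (D φ i x) ^ 2) / 4) := by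
  have hdiff : ∀ x ∈ X, ContDiff ℝ r₀ (fun φ : (Fin 4 → ZMod n) → ℝ => K (fun i => D φ i x)) :=
    fun x _ => contDiff_pertSite hK.1 x
  refine (tayNorm_prod_le (fieldGauge 𝔥 R p S) X hdiff φ).trans ?_
  calc ∏ x ∈ X, tayNorm (fieldGauge 𝔥 R p S) r₀
          (fun φ : (Fin 4 → ZMod n) → ℝ => K (fun i => D φ i x)) φ
      ≤ ∏ x ∈ X, (ρ * Real.exp (𝔥 / R) * Real.exp ((∑ i : Fin 4, (D φ i x) ^ 2) / 4)) :=
        Finset.prod_le_prod (fun x _ => tayNorm_nonneg _ _ _ _)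
          fun x hx => tayNorm_pertSite_le hK h𝔥 hR hp (hXS hx) φ
    _ = (ρ * Real.exp (𝔥 / R)) ^ X.card *
          Real.exp ((∑ x ∈ X, ∑ i : Fin 4, (D φ i x) ^ 2) / 4) := by
        rw [Finset.prod_mul_distrib, Finset.prod_const, ← Real.exp_sum, Finset.sum_div]

/-! ## `ι`-symmetry and the Taylor norm

The reflection `ι F (φ) = conj F(−φ)` of the route (files `…HypACumulantIota.lean`): the Taylor norm
relative to ANY gauge is `ι`-invariant up to `φ ↦ −φ`, so on the `ι`-symmetric class the norm is an
even function of the field — the norms of [ABKM19] are blind to the complex structure, as the line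
`gnv` claims. -/

section Iota

open scoped ComplexConjugate

variable {E V : Type*} [NormedAddCommGroup E] [NormedSpace ℝ E]
  [NormedAddCommGroup V] [NormedSpace ℝ V]

omit [NeZero n] in
/-- **`‖ι F‖_{T_φ} = ‖F‖_{T_{−φ}}`**: complex conjugation is a real linear isometry of `ℂ` and
`φ ↦ −φ` a linear isometry of the gauge space, so the Taylor norm of `ι F = conj ∘ F ∘ (−·)` at `φ`
is the Taylor norm of `F` at `−φ`, for every gauge `T`. -/
theorem tayNorm_conj_neg (T : E →ₗ[ℝ] V) (r₀ : ℕ) (F : E → ℂ) (φ : E) :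
    tayNorm T r₀ (fun ψ => conj (F (-ψ))) φ = tayNorm T r₀ F (-φ) := by
  unfold tayNorm
  refine Finset.sum_congr rfl fun s _ => ?_
  congr 1
  have hlift : Literature.MathematicalPhysics.StatisticalMechanics.GradientRG.gaugeLift T
      (fun ψ => conj (F (-ψ))) =
      Complex.conjLIE ∘ (Literature.MathematicalPhysics.StatisticalMechanics.GradientRG.gaugeLift T F ∘
        (LinearIsometryEquiv.neg ℝ : LinearMap.range T ≃ₗᵢ[ℝ] LinearMap.range T)) := by
    funext w
    simp only [Function.comp_apply, LinearIsometryEquiv.coe_neg,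
      Literature.MathematicalPhysics.StatisticalMechanics.GradientRG.gaugeLift_apply, map_neg]
    rfl
  rw [hlift, LinearIsometryEquiv.norm_iteratedFDeriv_comp_left,
    LinearIsometryEquiv.norm_iteratedFDeriv_comp_right, LinearIsometryEquiv.coe_neg, map_neg]

omit [NeZero n] in
/-- On the `ι`-symmetric class (`F(−ψ) = conj F(ψ)`) the Taylor norm is an EVEN function of the
field: `‖F‖_{T_{−φ}} = ‖F‖_{T_φ}`. -/
theorem tayNorm_neg_of_iota (T : E →ₗ[ℝ] V) (r₀ : ℕ) {F : E → ℂ}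
    (hF : ∀ ψ, F (-ψ) = conj (F ψ)) (φ : E) :
    tayNorm T r₀ F (-φ) = tayNorm T r₀ F φ := by
  rw [← tayNorm_conj_neg T r₀ F φ]
  congr 1
  funext ψ
  rw [hF, Complex.conj_conj]

omit [NeZero n] in
/-- The polymer activity of an `ι`-admissible perturbation is `ι`-symmetric:
`∏_{x∈X} K(∇(−φ)(x)) = conj ∏_{x∈X} K(∇φ(x))`. -/
theorem pertActivity_iota {r₀ : ℕ} {ρ : ℝ} {K : (Fin 4 → ℝ) → ℂ} (hK : IsIotaAdmissible r₀ ρ K)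
    (X : Finset (Fin 4 → ZMod n)) (φ : (Fin 4 → ZMod n) → ℝ) :
    (∏ x ∈ X, K (fun i => D (-φ) i x)) = conj (∏ x ∈ X, K (fun i => D φ i x)) := by
  rw [map_prod]
  refine Finset.prod_congr rfl fun x _ => ?_
  rw [← hK.2.2]
  congr 1
  funext i
  simp only [Pi.neg_apply, D]
  ring

/-- Hence the Taylor norm of the activity of an `ι`-admissible `K` is even in the field, for every
gauge on the space of fields. -/
theorem tayNorm_pertActivity_neg {W : Type*} [NormedAddCommGroup W] [NormedSpace ℝ W]
    (T : ((Fin 4 → ZMod n) → ℝ) →ₗ[ℝ] W) {r₀ r : ℕ} {ρ : ℝ} {K : (Fin 4 → ℝ) → ℂ}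
    (hK : IsIotaAdmissible r₀ ρ K) (X : Finset (Fin 4 → ZMod n)) (φ : (Fin 4 → ZMod n) → ℝ) :
    tayNorm T r (fun φ : (Fin 4 → ZMod n) → ℝ => ∏ x ∈ X, K (fun i => D φ i x)) (-φ) =
      tayNorm T r (fun φ : (Fin 4 → ZMod n) → ℝ => ∏ x ∈ X, K (fun i => D φ i x)) φ :=
  tayNorm_neg_of_iota T r (fun ψ => pertActivity_iota hK X ψ) φ

end Iota

end Summit.HubbardSuperconductivity.HubbardSuperconductivity.Theorems.ComplexGFF

end
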